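import Summits.FinalStateConjecture.FinalStateConjecture.Theorems.EIHFluxBalanceInertialRecessionStubIdentificationLinear
import Summits.FinalStateConjecture.FinalStateConjecture.Theorems.EIHFluxBalanceEIHFluxEvaluationKSBoost

/-!
# Route EIHFluxBalance — `InertialRecession`, line `sublinear-is-free-clean-window-charges`:
# scaling laws of the Landau–Lifshitz four-momentum of the Kerr family (stub `stub_identification`,
# part A3a)

Helper file (`--supports stmt-FinalStateConjecture-10166`) for the crux
`Summit.FinalStateConjecture.FinalStateConjecture.Theses.EIHFluxBalance.InertialRecession`.

Towards the rest-frame value `P^μ[g_{M,a}] = M δ^μ_0` of a SPINNING Kerr hole (the boosted value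
`Mγ(1, v)` then follows from `quasiLocalMomentum_linChart_static`, which is spin-agnostic): the three
exact scaling laws of the Landau–Lifshitz four-momentum of the Kerr–Schild family on centred
coordinate spheres,
* `hField_const_smul` — `h[c·g] = c² h[g]` (a constant conformal factor; `H` is quadratic in `𝔤`);
* `hField_kerr_dilate`, `quasiLocalMomentum_kerr_dilate` — the dilation covariance
  `g_{λM,λa}(x) = g_{M,a}(x/λ)` of the Kerr–Schild components (`Kerr.bilin_dilate`) read through the
  linear change of chart `x ↦ x/λ` (`hField_linChart`): `h[g_{λM,λa}](x) = λ⁻¹ h[g_{M,a}](x/λ)` and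
  `P^μ[g_{λM,λa}](0; 0, λR) = λ P^μ[g_{M,a}](0; 0, R)`;
* `hField_kerr_mass`, `quasiLocalMomentum_kerr_mass` — linearity in the mass,
  `P^μ[g_{M,a}] = M P^μ[g_{1,a}]` (`KSFlux.hField_ksFamily`);
whence `quasiLocalMomentum_kerr_spin_rescale`: `P^μ[g_{M,a}](0; 0, R) = P^μ[g_{M,a/λ}](0; 0, R)`
for every `λ ≥ 1` (with the sphere independence `KSFlux.quasiLocalMomentum_boostedKerr_shell`): the
rest charge of a Kerr hole does not see the spin except possibly through a jump at `a = 0`, excluded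
by continuity in the companion file. [cite: LandauLifshitz1975, §96 (96.16)]
-/

set_option linter.dupNamespace false

noncomputable section

-- instance search on the nested operator spaces `E4 →L[ℝ] E4 →L[ℝ] ℝ` is deep
set_option maxSynthPendingDepth 3

open Set Metric Filter MeasureTheory MeasureTheory.Measure Module
open scoped Topology ContDiff RealInnerProductSpace Matrix

namespace Summit.FinalStateConjecture.FinalStateConjecture.Theorems

namespace SublinearIsFree.ChargeModel

open Literature.Geometry.Lorentzian Literature.Geometry.Lorentzian.LandauLifshitz
open LLBalance LLGauss

variable {g : E4 → E4 →L[ℝ] E4 →L[ℝ] ℝ}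

/-! ### A constant conformal factor -/

/-- `gram (c g) = c • gram g`. [folklore] -/
theorem gram_field_const_smul (c : ℝ) (g : E4 → E4 →L[ℝ] E4 →L[ℝ] ℝ) (y : E4) :
    gram (fun z ↦ c • g z) y = c • gram g y := by
  ext μ ν
  simp [gram_apply, Matrix.smul_apply]

/-- **The superpotential under a constant conformal factor**: `H[c·g] = c² H[g]` (identically,
including the degenerate values). [cite: LandauLifshitz1975, §96 (96.3)] -/
theorem superpotential_const_smul (c : ℝ) (g : E4 → E4 →L[ℝ] E4 →L[ℝ] ℝ) (y : E4)
    (μ α ν β : Fin 4) :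
    superpotential (fun z ↦ c • g z) y μ α ν β = c ^ 2 * superpotential g y μ α ν β := by
  have hdet : metricDet (fun z ↦ c • g z) y = c ^ 4 * metricDet g y := by
    rw [metricDet, metricDet, gram_field_const_smul, Matrix.det_smul, Fintype.card_fin]
  by_cases hc : c = 0
  · subst hc
    rw [superpotential, superpotential, hdet]
    ring
  by_cases hd : metricDet g y = 0
  · rw [superpotential, superpotential, hdet, hd]
    ring
  have hinv : upper (fun z ↦ c • g z) y = c⁻¹ • upper g y := by
    have hunit : IsUnit (gram g y).det := isUnit_iff_ne_zero.2 hd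
    rw [upper, upper, gram_field_const_smul]
    refine Matrix.inv_eq_left_inv ?_
    rw [Matrix.smul_mul, Matrix.mul_smul, Matrix.nonsing_inv_mul _ hunit, smul_smul,
      inv_mul_cancel₀ hc, one_smul]
  rw [superpotential, superpotential, hdet, hinv]
  simp only [Matrix.smul_apply, smul_eq_mul]
  field_simp

/-- **LL's `h^{μνα}` under a constant conformal factor**: `h[c·g] = c² h[g]` for `c ≠ 0`.
[cite: LandauLifshitz1975, §96 (96.2)] -/
theorem hField_const_smul {c : ℝ} (hc : c ≠ 0) (g : E4 → E4 →L[ℝ] E4 →L[ℝ] ℝ) (x : E4)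
    (μ ν α : Fin 4) : hField (fun z ↦ c • g z) x μ ν α = c ^ 2 * hField g x μ ν α := by
  haveI : Invertible (c ^ 2) := invertibleOfNonzero (pow_ne_zero 2 hc)
  rw [hField, hField, Finset.mul_sum, Finset.mul_sum, Finset.mul_sum]
  refine Finset.sum_congr rfl fun β _ ↦ ?_
  have hfun : (fun y ↦ superpotential (fun z ↦ c • g z) y μ β ν α) =
      (c ^ 2) • fun y ↦ superpotential g y μ β ν α := by
    funext y
    rw [Pi.smul_apply, smul_eq_mul]
    exact superpotential_const_smul c g y μ β ν α
  rw [partialDeriv_apply, partialDeriv_apply, hfun, fderiv_const_smul_of_invertible]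
  simp only [FunLike.coe_smul, Pi.smul_apply, smul_eq_mul]
  ring

/-! ### Dilations -/

/-- The dilation `x ↦ c x` of `E4` as a continuous linear automorphism (`c ≠ 0`). [folklore] -/
theorem exists_dilationEquiv {c : ℝ} (hc : c ≠ 0) :
    ∃ L : E4 ≃L[ℝ] E4, (∀ x, L x = c • x) ∧ ∀ x, L.symm x = c⁻¹ • x := by
  refine ⟨ContinuousLinearEquiv.equivOfInverse (c • ContinuousLinearMap.id ℝ E4)
    (c⁻¹ • ContinuousLinearMap.id ℝ E4) (fun x ↦ ?_) (fun x ↦ ?_), fun x ↦ rfl, fun x ↦ rfl⟩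
  · simp [smul_smul, mul_inv_cancel₀ hc]
  · simp [smul_smul, inv_mul_cancel₀ hc]

/-- The coordinate matrix of a dilation is scalar: `(c·x)` has matrix `c·1`. [folklore] -/
theorem matrix_of_dilation {L : E4 →L[ℝ] E4} {c : ℝ} (hL : ∀ x, L x = c • x) :
    (Matrix.of fun i j : Fin 4 ↦ (L (E4.basisVector j)) i) = c • (1 : Matrix (Fin 4) (Fin 4) ℝ) := by
  ext i j
  rw [Matrix.of_apply, hL, Matrix.smul_apply, Matrix.one_apply]
  by_cases h : i = j
  · subst h; simp
  · simp [h]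

/-- **LL's `h^{μνα}` of the dilated Kerr–Schild components**: for `λ > 0` and `x` with
`r_a(x/λ) > 0`, `h[g_{λM,λa}](x) = λ⁻¹ h[g_{M,a}](x/λ)` (dilation covariance of the Kerr–Schild
form, `Kerr.bilin_dilate`, read through the linear change of chart `x ↦ x/λ` and the conformal
factor `λ²`). [cite: KerrSchild1965, §2] -/
theorem hField_kerr_dilate {lam : ℝ} (hlam : 0 < lam) (M a : ℝ) {x : E4}
    (hx : 0 < Kerr.radius a (lam⁻¹ • x)) (μ ν α : Fin 4) :
    hField (Kerr.bilin (lam * M) (lam * a)) x μ ν α =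
      lam⁻¹ * hField (Kerr.bilin M a) (lam⁻¹ • x) μ ν α := by
  have hlam0 : lam ≠ 0 := hlam.ne'
  have hlami : lam⁻¹ ≠ 0 := inv_ne_zero hlam0
  obtain ⟨L, hL, hLs⟩ := exists_dilationEquiv hlami
  -- the pulled-back field and the dilated Kerr components
  set g' : E4 → E4 →L[ℝ] E4 →L[ℝ] ℝ := fun y ↦ lam⁻¹ ^ 2 • Kerr.bilin M a (lam⁻¹ • y) with hg'
  have hg'L : ∀ y v w, g' y v w = Kerr.bilin M a (L y) (L v) (L w) := fun y v w ↦ by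
    simp only [hg', hL, _root_.smul_apply, map_smul, smul_eq_mul]
    ring
  have hdil : Kerr.bilin (lam * M) (lam * a) = fun y ↦ lam ^ 2 • g' y := by
    funext y
    have h := Kerr.bilin_dilate hlam M a (lam⁻¹ • y)
    rw [smul_smul, mul_inv_cancel₀ hlam0, one_smul] at h
    rw [h, hg', smul_smul, ← mul_pow, mul_inv_cancel₀ hlam0, one_pow, one_smul]
  -- differentiability of the superpotential of `g_{M,a}` at `x/λ`
  have hreg : ContDiffOn ℝ ∞ (Kerr.bilin M a) (Kerr.region a 0 : Set E4) := fun y hy ↦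
    (Kerr.contDiffAt_bilin M a (Kerr.radius_pos_of_mem_region hy)).contDiffWithinAt
  have hdetr : ∀ y ∈ (Kerr.region a 0 : Set E4), metricDet (Kerr.bilin M a) y ≠ 0 := fun y hy ↦ by
    rw [show metricDet (Kerr.bilin M a) y = -1 from
      KSMatrix.metricDet_kerr M a (Kerr.radius_pos_of_mem_region hy)]
    norm_num
  have hxr : lam⁻¹ • x ∈ (Kerr.region a 0 : Set E4) := by
    rw [SetLike.mem_coe, Kerr.mem_region, max_self]
    exact hx
  have hH : ∀ i α' j β, DifferentiableAt ℝ (fun y ↦ superpotential (Kerr.bilin M a) y i α' j β) (L x) :=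
    fun i α' j β ↦ by
      rw [hL]
      exact ((contDiffOn_superpotential hreg hdetr i α' j β).contDiffAt
        ((Kerr.region a 0).isOpen.mem_nhds hxr)).differentiableAt (by simp)
  -- the two scaling laws
  rw [hdil, hField_const_smul (pow_ne_zero 2 hlam0), hField_linChart L hg'L hH μ ν α,
    matrix_of_dilation hL, matrix_of_dilation hLs, inv_inv, Matrix.det_smul, Matrix.det_one,
    Fintype.card_fin, hL]
  simp only [Matrix.smul_apply, Matrix.one_apply, smul_eq_mul, mul_ite, mul_one, mul_zero, ite_mul,
    zero_mul, Finset.sum_ite_eq, Finset.mem_univ, if_true]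
  field_simp

/-- `λ⁻¹ · (0, λR ω) = (0, R ω)` (bookkeeping). [folklore] -/
theorem inv_smul_ofTimeSpace_zero {lam : ℝ} (hlam : lam ≠ 0) (R : ℝ) (θ : E3) :
    lam⁻¹ • E4.ofTimeSpace 0 ((lam * R) • θ) = E4.ofTimeSpace 0 (R • θ) := by
  rw [Kerr.smul_ofTimeSpace, mul_zero, smul_smul, ← mul_assoc, inv_mul_cancel₀ hlam, one_mul]

/-- **Dilation law of the quasi-local four-momentum of the Kerr family** on centred spheres:
`P^μ[g_{λM,λa}](0; 0, λR) = λ P^μ[g_{M,a}](0; 0, R)` (`λ > 0`, `R > |a|`).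
[cite: LandauLifshitz1975, §96 (96.16)] -/
theorem quasiLocalMomentum_kerr_dilate {lam : ℝ} (hlam : 0 < lam) (M a : ℝ) {R : ℝ}
    (haR : |a| < R) (μ : Fin 4) :
    quasiLocalMomentum (Kerr.bilin (lam * M) (lam * a)) 0 0 (lam * R) μ =
      lam * quasiLocalMomentum (Kerr.bilin M a) 0 0 R μ := by
  have hR : 0 < R := (abs_nonneg a).trans_lt haR
  have hlam0 : lam ≠ 0 := hlam.ne'
  have hlR : 0 < lam * R := mul_pos hlam hR
  have h3 : finrank ℝ E3 = 3 := finrank_euclideanSpace_fin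
  unfold quasiLocalMomentum
  rw [Literature.MeasureTheory.Hausdorff.setIntegral_sphere_euclideanHausdorff_three h3 hlR,
    Literature.MeasureTheory.Hausdorff.setIntegral_sphere_euclideanHausdorff_three h3 hR,
    Literature.Analysis.FluidPDE.sphereIntegral_def, Literature.Analysis.FluidPDE.sphereIntegral_def,
    smul_eq_mul, smul_eq_mul]
  have hpt : ∀ θ : E3, ‖θ‖ = 1 →
      (∑ j : Fin 3, hField (Kerr.bilin (lam * M) (lam * a)) (E4.ofTimeSpace 0 ((lam * R) • θ)) μ 0 j.succ *
        ((lam * R) • θ - 0) j / (lam * R)) =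
      lam⁻¹ * ∑ j : Fin 3, hField (Kerr.bilin M a) (E4.ofTimeSpace 0 (R • θ)) μ 0 j.succ *
        (R • θ - 0) j / R := by
    intro θ hθ
    have hrad : 0 < Kerr.radius a (lam⁻¹ • E4.ofTimeSpace 0 ((lam * R) • θ)) := by
      rw [inv_smul_ofTimeSpace_zero hlam0]
      refine Kerr.radius_pos_of_abs_lt ?_
      rw [E4.spatialNorm_ofTimeSpace, norm_smul, hθ, mul_one, Real.norm_of_nonneg hR.le]
      exact haR
    rw [Finset.mul_sum]
    refine Finset.sum_congr rfl fun j _ ↦ ?_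
    rw [sub_zero, sub_zero, hField_kerr_dilate hlam M a hrad, inv_smul_ofTimeSpace_zero hlam0]
    simp only [PiLp.smul_apply, smul_eq_mul]
    field_simp
  calc (lam * R) ^ 2 * ∫ θ, (∑ j : Fin 3, hField (Kerr.bilin (lam * M) (lam * a))
        (E4.ofTimeSpace 0 ((lam * R) • ((θ : ↥(sphere (0 : E3) 1)) : E3))) μ 0 j.succ *
          ((lam * R) • ((θ : ↥(sphere (0 : E3) 1)) : E3) - 0) j / (lam * R)) ∂(volume : Measure E3).toSphere
      = (lam * R) ^ 2 * ∫ θ, lam⁻¹ * ∑ j : Fin 3, hField (Kerr.bilin M a)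
          (E4.ofTimeSpace 0 (R • ((θ : ↥(sphere (0 : E3) 1)) : E3))) μ 0 j.succ *
            (R • ((θ : ↥(sphere (0 : E3) 1)) : E3) - 0) j / R ∂(volume : Measure E3).toSphere := by
        congr 1
        exact integral_congr_ae (ae_of_all _ fun θ ↦ hpt θ (by simp))
    _ = lam * (R ^ 2 * ∫ θ, ∑ j : Fin 3, hField (Kerr.bilin M a)
          (E4.ofTimeSpace 0 (R • ((θ : ↥(sphere (0 : E3) 1)) : E3))) μ 0 j.succ *
            (R • ((θ : ↥(sphere (0 : E3) 1)) : E3) - 0) j / R ∂(volume : Measure E3).toSphere) := by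
        rw [integral_const_mul]
        field_simp

/-! ### Linearity in the mass -/

/-- **`h[g_{M,a}] = M h[g_{1,a}]`** at points of positive Kerr–Schild radius: the mass is the
Kerr–Schild family parameter and `h` is linear in it (`KSFlux.hField_ksFamily`).
[cite: LandauLifshitz1975, §96 (96.2)] -/
theorem hField_kerr_mass (M a : ℝ) {x : E4} (hx : 0 < Kerr.radius a x) (μ ν α : Fin 4) :
    hField (Kerr.bilin M a) x μ ν α = M * hField (Kerr.bilin 1 a) x μ ν α := by
  have hxr : x ∈ (Kerr.region a 0 : Set E4) := by
    rw [SetLike.mem_coe, Kerr.mem_region, max_self]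
    exact hx
  have hM := KSFlux.hField_ksFamily (Kerr.region a 0).isOpen (KSFlux.contDiffOn_kerr_sub_minkowski a 0)
    (fun y hy ↦ KSFlux.kerr_nullRankOne a (Kerr.radius_pos_of_mem_region hy)) hxr M μ ν α
  have h1 := KSFlux.hField_ksFamily (Kerr.region a 0).isOpen (KSFlux.contDiffOn_kerr_sub_minkowski a 0)
    (fun y hy ↦ KSFlux.kerr_nullRankOne a (Kerr.radius_pos_of_mem_region hy)) hxr 1 μ ν α
  rw [← KSFlux.kerr_bilin_eq_ksFamily] at hM h1
  rw [hM, h1, one_mul]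

/-- **`P^μ[g_{M,a}](0; 0, R) = M P^μ[g_{1,a}](0; 0, R)`** for `R > |a|`.
[cite: LandauLifshitz1975, §96 (96.16)] -/
theorem quasiLocalMomentum_kerr_mass (M a : ℝ) {R : ℝ} (haR : |a| < R) (t : ℝ) (μ : Fin 4) :
    quasiLocalMomentum (Kerr.bilin M a) t 0 R μ = M * quasiLocalMomentum (Kerr.bilin 1 a) t 0 R μ := by
  unfold quasiLocalMomentum
  rw [← integral_const_mul]
  refine setIntegral_congr_fun isClosed_sphere.measurableSet fun y hy ↦ ?_
  have hrad : 0 < Kerr.radius a (E4.ofTimeSpace t y) := by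
    refine Kerr.radius_pos_of_abs_lt ?_
    rw [E4.spatialNorm_ofTimeSpace]
    rw [mem_sphere, dist_zero_right] at hy
    rwa [hy]
  rw [Finset.mul_sum]
  refine Finset.sum_congr rfl fun j _ ↦ ?_
  rw [hField_kerr_mass M a hrad]
  ring

/-! ### The rest charge does not see the spin away from `a = 0` -/

/-- **Sphere independence for a Kerr hole at rest**: `P^μ[g_{M,a}](t; 0, R') = P^μ[g_{M,a}](t; 0, R)`
for `|a| < R < R'` (`KSFlux.quasiLocalMomentum_boostedKerr_shell` with the trivial motion).
[cite: LandauLifshitz1975, §96 (96.17)] -/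
theorem quasiLocalMomentum_kerr_shell (M a : ℝ) {t R R' : ℝ} (haR : |a| < R) (hRR' : R < R')
    (μ : Fin 4) :
    quasiLocalMomentum (Kerr.bilin M a) t 0 R' μ = quasiLocalMomentum (Kerr.bilin M a) t 0 R μ := by
  have hR : 0 < R := (abs_nonneg a).trans_lt haR
  have hg : ContDiffOn ℝ ∞ (Kerr.bilin M a) (Kerr.region a 0 : Set E4) := fun y hy ↦
    (Kerr.contDiffAt_bilin M a (Kerr.radius_pos_of_mem_region hy)).contDiffWithinAt
  have hdet : ∀ x ∈ (Kerr.region a 0 : Set E4), metricDet (Kerr.bilin M a) x < 0 := fun x hx ↦ by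
    rw [show metricDet (Kerr.bilin M a) x = -1 from
      KSMatrix.metricDet_kerr M a (Kerr.radius_pos_of_mem_region hx)]
    norm_num
  have hKU : ∀ y ∈ closedBall (0 : E3) R' \ ball 0 R, E4.ofTimeSpace t y ∈ (Kerr.region a 0 : Set E4) := by
    intro y hy
    rw [SetLike.mem_coe, Kerr.mem_region, max_self]
    refine Kerr.radius_pos_of_abs_lt ?_
    have hy' : R ≤ ‖y‖ := by
      have h2 := hy.2
      rw [mem_ball, dist_zero_right, not_lt] at h2
      exact h2
    rw [E4.spatialNorm_ofTimeSpace]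
    exact haR.trans_le hy'
  have h := LLGauss.shellGaussLaw (Kerr.region a 0).isOpen hg hdet
    (fun x hx ↦ KSFlux.ricAt_kerr_eq_zero M a 0 hx) hR (closedBall_subset_ball hRR') hKU μ
  rw [setIntegral_eq_zero_of_forall_eq_zero fun y hy ↦ by
    rw [KSFlux.pseudotensor_kerr_eq_zero M a 0 (hKU y hy), mul_zero]] at h
  exact sub_eq_zero.mp h

/-- **The rest charge of a Kerr hole does not see the spin away from `a = 0`**:
`P^μ[g_{M,a}](0; 0, R) = P^μ[g_{M,a/λ}](0; 0, R)` for `R > |a|`, `λ ≥ 1` (sphere independence, the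
dilation law with `(M, a) = λ · (M/λ, a/λ)`, and linearity in the mass).
[cite: LandauLifshitz1975, §96 (96.16)] -/
theorem quasiLocalMomentum_kerr_spin_rescale (M a : ℝ) {R lam : ℝ} (haR : |a| < R) (hlam : 1 ≤ lam)
    (μ : Fin 4) :
    quasiLocalMomentum (Kerr.bilin M a) 0 0 R μ = quasiLocalMomentum (Kerr.bilin M (a / lam)) 0 0 R μ := by
  have hR : 0 < R := (abs_nonneg a).trans_lt haR
  have hlam0 : 0 < lam := one_pos.trans_le hlam
  have haR' : |a / lam| < R := by
    rw [abs_div, abs_of_pos hlam0, div_lt_iff₀ hlam0]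
    nlinarith
  rcases hlam.eq_or_lt with h | h
  · rw [← h, div_one]
  -- move to the sphere of radius `λR`, dilate, and use linearity in the mass twice
  have hshell := quasiLocalMomentum_kerr_shell M a (t := 0) haR
    ((lt_mul_iff_one_lt_left hR).2 h) μ
  have hdil := quasiLocalMomentum_kerr_dilate hlam0 (M / lam) (a / lam) haR' μ
  rw [mul_div_cancel₀ _ hlam0.ne', mul_div_cancel₀ _ hlam0.ne'] at hdil
  rw [← hshell, hdil, quasiLocalMomentum_kerr_mass (M / lam) (a / lam) haR',
    quasiLocalMomentum_kerr_mass M (a / lam) haR']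
  field_simp

end SublinearIsFree.ChargeModel

/-- Registered sub-goal form (stub `ll_kerr_spin_rescale` of the crux item) of
`SublinearIsFree.ChargeModel.quasiLocalMomentum_kerr_spin_rescale`: the rest charge of a Kerr hole does
not see the spin away from `a = 0`. [cite: LandauLifshitz1975, §96 (96.16)] -/
theorem ll_kerr_spin_rescale : open Literature.Geometry.Lorentzian in ∀ (M a : ℝ) {R lam : ℝ}, |a| < R → 1 ≤ lam → ∀ μ : Fin 4, LandauLifshitz.quasiLocalMomentum (Kerr.bilin M a) 0 0 R μ = LandauLifshitz.quasiLocalMomentum (Kerr.bilin M (a / lam)) 0 0 R μ :=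
  fun M a _R _lam haR hlam μ ↦ SublinearIsFree.ChargeModel.quasiLocalMomentum_kerr_spin_rescale M a haR hlam μ

end Summit.FinalStateConjecture.FinalStateConjecture.Theorems

end
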